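import Summits.HodgeConjecture.HodgeConjecture.Theorems.F0P6aKillEngineWLayerW
import HarnessLib

/-!
# `F0P6aKillEngineWSpecialW` — ★ RE-HOME of `Lines/F0_P6a_KillEngineW.lean` (tree sha16 9e31b9f7f48926b4), PART 2 of 3 — tree lines :365–:698.

See PART 1 `Theorems/F0P6aKillEngineWLayerW.lean` for the full ★ re-home header and the original module docstring (verbatim there).  Same namespace (every fully-qualified name unchanged);
the scopes open at the cut (`noncomputable section` ∕ `namespace` ∕ `section`s) are re-opened below with their `variable` ∕ `open` ∕ `set_option` ∕ `omit` ∕ `include` ∕ `universe` lines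
replayed verbatim from the tree, in order; the code after the replay block is the tree bytes :365–:698, untouched.  HC_CM is proved only modulo the 7 printed citations (2 remaining: hLiu418 = stmt-HodgeConjecture-24832, h413 = stmt-HodgeConjecture-24833) until rung 0 closes; a re-home is count-neutral.
-/

-- ── replay of the scopes open at tree line :365 (verbatim) ──
set_option autoImplicit false
set_option linter.dupNamespace false
noncomputable section
namespace Summit.HodgeConjecture.HodgeConjecture.Cruxes.HLiu418.F0P6aLineSpecialisation
open CategoryTheory CategoryTheory.Limits NumberField IsDedekindDomain MulAction AlgebraicGeometry
open scoped Matrix Polynomial Pointwise MonoidalCategory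
open Literature.NumberTheory.GaloisRepresentations
open Literature.NumberTheory.Automorphic Literature.NumberTheory.Automorphic.UnitaryGroup
open Literature.AlgebraicGeometry.ShimuraVarieties.UnitaryCanonicalModel
open Literature.NumberTheory.Automorphic.Liu2021.AppendixC
open Literature.AlgebraicGeometry.Motives (AlgPoints IntegralModel SchemeOver thickening thickeningGalAction thickeningLift specOver extendPoint
  specValuationSubring specFractionFieldι specRingHomι)
open Literature.NumberTheory.DiophantineGeometry (geomResidueField specialFibreFunctor specResidueField geomClosedPointIsoSpecResidueField
  geomResidueFieldEquiv toClosureValuationSubring)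
open Literature.AlgebraicGeometry.RelativeSpec (ActionOver)
open Literature.NumberTheory.EllipticCurves (genericFibre specGenericPoint)
open Literature.AlgebraicGeometry.AbelianSchemes Literature.AlgebraicGeometry.AbelianSchemes.AbelianSchemeOver
open Literature.AlgebraicGeometry.GroupSchemes.AffineGroupScheme (Alg)
open Summit.HodgeConjecture.HodgeConjecture.Cruxes.HLiu418.F0P6aModuliDatumDefs
open Summit.HodgeConjecture.HodgeConjecture.Cruxes.HLiu418.F0P6aRGDAssembly
open Summit.HodgeConjecture.HodgeConjecture.Cruxes.HLiu418.F0P6aDatumOfInputs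
section GenericW
set_option synthInstance.maxHeartbeats 100000
open Literature.AlgebraicGeometry.GroupSchemes (GroupSchemeKernel.ker GroupSchemeKernel.kerι)
open Literature.AlgebraicGeometry.GroupSchemes.AffineGroupScheme (ptEquiv)
variable {F : Type} [Field F] [NumberField F] [IsCMField F] {ι₁ : F →+* ℂ}
    {Jstar : Matrix (Fin 2) (Fin 2) F}
    {K₀ : C5.OpenCompactSubgroup ↥(finAdelic ↥(maximalRealSubfield F) F (IsCMField.complexConj F) 2 Jstar)}
    {S : RecordSystemGS F Jstar ι₁ K₀} {hU7ₛ : S.HeckeTranslateDefinedOver}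
    {hJ : (Jstar.map (IsCMField.complexConj F))ᵀ = Jstar} {hJu : IsUnit Jstar}
    {Fi : Type} [Field Fi] [Algebra F Fi] {Kc : C5.SmallLevel K₀} {G : Type} [Group G]
    {𝓜 : IntegralModel (𝓞 F) F ((thickening F Fi).obj (S.M.obj Kc))}
    {w : HeightOneSpectrum (𝓞 F)} {hw : (IsCMField.complexConj F) • w ≠ w} {h𝓨 : (𝓜.localise w).IsSmoothProper 1}
    {θ : ActionOver (𝓜.localise w).total.hom ((Fi ≃ₐ[F] Fi) × G)}
    {e : Fi →ₐ[F] AlgebraicClosure (w.adicCompletion F)}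
variable (I : RGDInputsAt F ι₁ Jstar K₀ S hU7ₛ hJ hJu Fi Kc G 𝓜 w hw h𝓨 θ e)
-- ── tree bytes :365–:698 ──

set_option maxHeartbeats 400000 in
open scoped MonObj CategoryTheory.Obj in
set_option backward.isDefEq.respectTransparency false in
/-- **e₁ — `LineOf I y` TRANSPORTED ALONG THE CHOSEN GENERIC PRESENTATION ISO** `φ := isoGenericOf I y` (★ (TR) `exists_equiv_stableSubgroups_map` at
`t ↦ t ≫ φ`, equivariance `actΩ_comp_isoGenericOf_hom`): lines of `A_y(Ω̄)` ≃ `𝒪_F`-stable order-`q` subgroups of `A_Ω̄(Ω̄)` killed by `𝔭_{c•w}`, `A_Ω̄ :=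
(univ ×_𝓨 Spec R) ×_R Ω̄`; membership: `x ∈ e₁ L ↔ x ≫ φ⁻¹ ∈ L`. [cite: Tate1997FiniteFlatGroupSchemes, (3.7)] [cite: BourbakiAlgebraI1989, Ch. I §4 no. 2 Def. 2–3 and no. 3 Def. 4] -/
theorem exists_equiv_lineWOf_stableSubgroups (y : AlgPoints (S.M.obj Kc) (AlgebraicClosure (w.adicCompletion F))) :
    ∃ E₁ : LineWOf I y ≃ {H : Subgroup (specOver (AlgebraicClosure (w.adicCompletion F)) (AlgebraicClosure (w.adicCompletion F)) ⟶ ((famOf I y).baseChange (sΩ w)).X) //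
        Nat.card ↥H = I.pChar ^ I.fDeg ∧ (∀ x ∈ H, ∀ a ∈ w.asIdeal, x ≫ ((actFamOf I y).baseChange (sΩ w)).i a = 1) ∧ ∀ a, ∀ x ∈ H, x ≫ ((actFamOf I y).baseChange (sΩ w)).i a ∈ H},
      ∀ (L : LineWOf I y) (x : (specOver (AlgebraicClosure (w.adicCompletion F)) (AlgebraicClosure (w.adicCompletion F)) ⟶ ((famOf I y).baseChange (sΩ w)).X)), x ∈ ((E₁ L).1 : Subgroup (specOver (AlgebraicClosure (w.adicCompletion F)) (AlgebraicClosure (w.adicCompletion F)) ⟶ ((famOf I y).baseChange (sΩ w)).X)) ↔ (x ≫ (isoGenericOf I y).inv : ((fibreΩOf S Kc 𝓜 w e I.univ y).Points (AlgebraicClosure (w.adicCompletion F)))) ∈ L.1 := by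
  haveI := isMonHom_isoGenericOf_hom I y
  have hφ : ∀ r : 𝓞 F, (isoGenericOf I y).hom ≫ ((actFamOf I y).baseChange (sΩ w)).i r = (actΩOf S Kc 𝓜 w e I.univ I.act r y).hom.hom.hom ≫ (isoGenericOf I y).hom :=
    fun r => (actΩ_comp_isoGenericOf_hom I y r).symm
  let eMul : ((fibreΩOf S Kc 𝓜 w e I.univ y).Points (AlgebraicClosure (w.adicCompletion F))) ≃* (specOver (AlgebraicClosure (w.adicCompletion F)) (AlgebraicClosure (w.adicCompletion F)) ⟶ ((famOf I y).baseChange (sΩ w)).X) :=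
    { toFun := fun t => t ≫ (isoGenericOf I y).hom, invFun := fun t => t ≫ (isoGenericOf I y).inv,
      left_inv := fun t => by simp only [Category.assoc, Iso.hom_inv_id, Category.comp_id],
      right_inv := fun t => by simp only [Category.assoc, Iso.inv_hom_id, Category.comp_id],
      map_mul' := fun a b => MonObj.mul_comp a b (isoGenericOf I y).hom }
  haveI : Mono (isoGenericOf I y).hom := ⟨fun g h hgh => (Iso.cancel_iso_hom_right g h (isoGenericOf I y)).mp hgh⟩
  obtain ⟨E₁, hE₁⟩ := Literature.GroupTheory.StableSubgroups.exists_equiv_stableSubgroups_map eMul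
    (fun (a : 𝓞 F) (t : ((fibreΩOf S Kc 𝓜 w e I.univ y).Points (AlgebraicClosure (w.adicCompletion F)))) =>
      (AlgPoints.map (actΩOf S Kc 𝓜 w e I.univ I.act a y).hom.hom.hom t : ((fibreΩOf S Kc 𝓜 w e I.univ y).Points (AlgebraicClosure (w.adicCompletion F)))))
    (fun (a : 𝓞 F) (t : (specOver (AlgebraicClosure (w.adicCompletion F)) (AlgebraicClosure (w.adicCompletion F)) ⟶ ((famOf I y).baseChange (sΩ w)).X)) => t ≫ ((actFamOf I y).baseChange (sΩ w)).i a)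
    (fun a t => by
      show (t ≫ (actΩOf S Kc 𝓜 w e I.univ I.act a y).hom.hom.hom) ≫ (isoGenericOf I y).hom = (t ≫ (isoGenericOf I y).hom) ≫ ((actFamOf I y).baseChange (sΩ w)).i a
      rw [Category.assoc, Category.assoc, hφ a])
    (fun t => IsIdealTorsionΩ S Kc 𝓜 w e I.univ I.act y w.asIdeal t)
    (fun (t : (specOver (AlgebraicClosure (w.adicCompletion F)) (AlgebraicClosure (w.adicCompletion F)) ⟶ ((famOf I y).baseChange (sΩ w)).X)) => ∀ a ∈ w.asIdeal, t ≫ ((actFamOf I y).baseChange (sΩ w)).i a = 1)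
    (fun t => by
      show (∀ a ∈ w.asIdeal, t ≫ (actΩOf S Kc 𝓜 w e I.univ I.act a y).hom.hom.hom = 1) ↔
        ∀ a ∈ w.asIdeal, (t ≫ (isoGenericOf I y).hom) ≫ ((actFamOf I y).baseChange (sΩ w)).i a = 1
      refine forall₂_congr fun a _ => ?_
      rw [Category.assoc, hφ a, ← Category.assoc]
      constructor
      · intro h; rw [h, MonObj.one_comp]
      · intro h; rw [← cancel_mono (isoGenericOf I y).hom, h, MonObj.one_comp])
    (I.pChar ^ I.fDeg)
  refine ⟨E₁, fun L x => ?_⟩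
  have h := hE₁ L
  have hx : x ∈ ((E₁ L).1 : Subgroup (specOver (AlgebraicClosure (w.adicCompletion F)) (AlgebraicClosure (w.adicCompletion F)) ⟶ ((famOf I y).baseChange (sΩ w)).X)) ↔ x ∈ L.1.map eMul.toMonoidHom := by rw [h]
  exact hx.trans Subgroup.mem_map_equiv

set_option maxHeartbeats 400000 in
open scoped MonObj CategoryTheory.Obj in
set_option backward.isDefEq.respectTransparency false in
/-- **e₂ — STABLE SUBGROUPS OF THE LAYER'S POINTS = STABLE `𝔭`-TORSION SUBGROUPS OF `A_Ω̄(Ω̄)`** (★ (UP-ADM) §3 `exists_equiv_subgroup_of_mono` at the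
monomorphic homomorphism `j := (ιRW)_Ω̄`, intertwining `(βRW a)_Ω̄` with `ι(a)_Ω̄` by `pullback_map_βR_comp`; the image clause `∃ s, s ≫ j = x` rewritten as
«killed by `𝔭_{c•w}`» by `exists_comp_pullback_map_ιR_iff`); membership: `s ≫ j ∈ e₂ H′ ↔ s ∈ H′`. [cite: Tate1997FiniteFlatGroupSchemes, (3.7)]
[cite: GortzWedhorn2023, §(27.2) (p. 606)] -/
theorem exists_equiv_layerWSubgroups_stableSubgroups (y : AlgPoints (S.M.obj Kc) (AlgebraicClosure (w.adicCompletion F))) :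
    haveI := isMonHom_transRW I y
    ∃ E₂ : {H' : Subgroup (specOver (AlgebraicClosure (w.adicCompletion F)) (AlgebraicClosure (w.adicCompletion F)) ⟶ layerΩW I y) //
        Nat.card ↥H' = I.pChar ^ I.fDeg ∧ ∀ a, ∀ x ∈ H', x ≫ (Over.pullback (sΩ w)).map (βRW I y a) ∈ H'} ≃ {H : Subgroup (specOver (AlgebraicClosure (w.adicCompletion F)) (AlgebraicClosure (w.adicCompletion F)) ⟶ ((famOf I y).baseChange (sΩ w)).X) //
        Nat.card ↥H = I.pChar ^ I.fDeg ∧ (∀ x ∈ H, ∀ a ∈ w.asIdeal, x ≫ ((actFamOf I y).baseChange (sΩ w)).i a = 1) ∧ ∀ a, ∀ x ∈ H, x ≫ ((actFamOf I y).baseChange (sΩ w)).i a ∈ H},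
      ∀ (H' : {H' : Subgroup (specOver (AlgebraicClosure (w.adicCompletion F)) (AlgebraicClosure (w.adicCompletion F)) ⟶ layerΩW I y) //
        Nat.card ↥H' = I.pChar ^ I.fDeg ∧ ∀ a, ∀ x ∈ H', x ≫ (Over.pullback (sΩ w)).map (βRW I y a) ∈ H'}) (s : (specOver (AlgebraicClosure (w.adicCompletion F)) (AlgebraicClosure (w.adicCompletion F)) ⟶ layerΩW I y)), s ≫ ((Over.pullback (sΩ w)).map (ιRW I y)) ∈ ((E₂ H').1 : Subgroup (specOver (AlgebraicClosure (w.adicCompletion F)) (AlgebraicClosure (w.adicCompletion F)) ⟶ ((famOf I y).baseChange (sΩ w)).X)) ↔ s ∈ (H'.1 : Subgroup (specOver (AlgebraicClosure (w.adicCompletion F)) (AlgebraicClosure (w.adicCompletion F)) ⟶ layerΩW I y)) := by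
  haveI := isMonHom_transRW I y
  haveI := mono_pullback_map_ιRW I y
  haveI : IsMonHom (M := layerΩW I y) (N := ((famOf I y).baseChange (sΩ w)).X) ((Over.pullback (sΩ w)).map (ιRW I y)) :=
    inferInstanceAs (IsMonHom ((Over.pullback (sΩ w)).map (ιRW I y)))
  obtain ⟨E₂, hE₂⟩ := Literature.AlgebraicGeometry.GroupSchemes.EtaleIdealPoints.exists_equiv_subgroup_of_mono (k := (AlgebraicClosure (w.adicCompletion F)))
    ((Over.pullback (sΩ w)).map (ιRW I y)) (fun a => (Over.pullback (sΩ w)).map (βRW I y a)) (fun a => ((actFamOf I y).baseChange (sΩ w)).i a)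
    (fun a => pullback_map_βRW_comp I y a) (I.pChar ^ I.fDeg)
  -- the image clause `∃ s, s ≫ j = x` IS the `𝔭`-torsion clause; reorder the conjuncts
  have hiff : ∀ H : Subgroup (specOver (AlgebraicClosure (w.adicCompletion F)) (AlgebraicClosure (w.adicCompletion F)) ⟶ ((famOf I y).baseChange (sΩ w)).X),
      (Nat.card ↥H = I.pChar ^ I.fDeg ∧ (∀ a, ∀ x ∈ H, x ≫ (fun a => ((actFamOf I y).baseChange (sΩ w)).i a) a ∈ H) ∧
          ∀ x ∈ H, ∃ s : (specOver (AlgebraicClosure (w.adicCompletion F)) (AlgebraicClosure (w.adicCompletion F)) ⟶ layerΩW I y), s ≫ ((Over.pullback (sΩ w)).map (ιRW I y)) = x) ↔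
      (Nat.card ↥H = I.pChar ^ I.fDeg ∧ (∀ x ∈ H, ∀ a ∈ w.asIdeal, x ≫ ((actFamOf I y).baseChange (sΩ w)).i a = 1) ∧ ∀ a, ∀ x ∈ H, x ≫ ((actFamOf I y).baseChange (sΩ w)).i a ∈ H) := fun H =>
    ⟨fun h => ⟨h.1, fun x hx => (exists_comp_pullback_map_ιRW_iff I y x).1 (h.2.2 x hx), h.2.1⟩,
      fun h => ⟨h.1, h.2.2, fun x hx => (exists_comp_pullback_map_ιRW_iff I y x).2 (h.2.1 x hx)⟩⟩
  refine ⟨E₂.trans (Equiv.subtypeEquivRight hiff), fun H' s => ?_⟩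
  rw [Equiv.trans_apply]
  exact hE₂ H' s

set_option maxHeartbeats 400000 in
open scoped MonObj CategoryTheory.Obj in
set_option backward.isDefEq.respectTransparency false in
/-- **§1c `exists_equiv_lineOf_admK` — THE LINES AT `y` ARE THE ADMISSIBLE IDEALS OF `layerΩ I y`, WITH THE MEMBERSHIP LAW**: a bijection `eL : LineWOf I y ≃ {J ∕∕ AdmKWOf I y J}`
(`η` is MonObj notation, hence the name) under which a point `s` of the generic layer kills `eL L` iff its image `s ≫ (ιRW)_Ω̄ ≫ (σ3)⁻¹` in `A_y(Ω̄)` lies on the line `L` — (σ3) `isoGenericOf` (equivariant), ★ (S-c) §3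
`exists_baseChange_iso` + §1 kernel-of-`𝔭` clause (`exists_comp_kerι_eq_iff_forall_mem`) for «killed by `𝔭_{c•w}`» ↔ «factors through the layer», ★ (UP-ADM) §3
`exists_equiv_subgroup_of_mono` and HEAD `exists_equiv_admissible` on the finite ÉTALE `layerΩ I y` (★ (GF) `etale_ker_serreTranslate_hom`, `NOf w ≠ 0` in `Ω̄` of
characteristic `0`; `Ω̄` algebraically closed).  Statement first. [cite: Tate1997FiniteFlatGroupSchemes, (3.7)] [cite: GortzWedhorn2023, §(27.2) (27.2.1) (p. 607)] -/
theorem exists_equiv_lineWOf_admKW (y : AlgPoints (S.M.obj Kc) (AlgebraicClosure (w.adicCompletion F))) :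
    haveI := isMonHom_transRW I y
    haveI := isAffine_layerΩW_left I y
    ∃ eL : LineWOf I y ≃ {J : Ideal (Alg (layerΩW I y)) // AdmKWOf I y J},
      ∀ (L : LineWOf I y) (s : specOver (AlgebraicClosure (w.adicCompletion F)) (AlgebraicClosure (w.adicCompletion F)) ⟶ layerΩW I y),
        (eL L).1 ≤ RingHom.ker (ptEquiv (layerΩW I y) (AlgebraicClosure (w.adicCompletion F)) s).toRingHom ↔
          (s ≫ (Over.pullback (sΩ w)).map (ιRW I y) ≫ (isoGenericOf I y).inv :
            (fibreΩOf S Kc 𝓜 w e I.univ y).Points (AlgebraicClosure (w.adicCompletion F))) ∈ L.1 := by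
  haveI := isMonHom_transRW I y
  haveI := isAffine_layerΩW_left I y
  haveI := isFinite_layerΩW_hom I y
  haveI := etale_layerΩW_hom I y
  -- e₁ (★ (TR)), e₂ (★ (UP-ADM) §3), e₃ (★ (UP-ADM) HEAD on the finite ÉTALE layer)
  obtain ⟨E₁, hE₁⟩ := exists_equiv_lineWOf_stableSubgroups I y
  obtain ⟨E₂, hE₂⟩ := exists_equiv_layerWSubgroups_stableSubgroups I y
  obtain ⟨E₃, hE₃⟩ := Literature.AlgebraicGeometry.GroupSchemes.EtaleIdealPoints.exists_equiv_admissible (k := (AlgebraicClosure (w.adicCompletion F)))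
    (layerΩW I y) (fun a => (Over.pullback (sΩ w)).map (βRW I y a)) (I.pChar ^ I.fDeg)
  refine ⟨E₁.trans (E₂.symm.trans E₃), fun L s => ?_⟩
  have h3 := hE₃ (E₂.symm (E₁ L)) s
  have h2 := hE₂ (E₂.symm (E₁ L)) s
  rw [Equiv.apply_symm_apply] at h2
  have h1 := hE₁ L (s ≫ (Over.pullback (sΩ w)).map (ιRW I y))
  exact h3.trans (h2.symm.trans (h1.trans (Iff.of_eq (by rw [Category.assoc]))))

end GenericW

section ELW

set_option synthInstance.maxHeartbeats 100000

open Literature.AlgebraicGeometry.GroupSchemes (GroupSchemeKernel.ker GroupSchemeKernel.kerι)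
open Literature.AlgebraicGeometry.GroupSchemes.AffineGroupScheme (ptEquiv)


variable {F : Type} [Field F] [NumberField F] [IsCMField F] {ι₁ : F →+* ℂ}
    {Jstar : Matrix (Fin 2) (Fin 2) F}
    {K₀ : C5.OpenCompactSubgroup ↥(finAdelic ↥(maximalRealSubfield F) F (IsCMField.complexConj F) 2 Jstar)}
    {S : RecordSystemGS F Jstar ι₁ K₀} {hU7ₛ : S.HeckeTranslateDefinedOver}
    {hJ : (Jstar.map (IsCMField.complexConj F))ᵀ = Jstar} {hJu : IsUnit Jstar}
    {Fi : Type} [Field Fi] [Algebra F Fi] {Kc : C5.SmallLevel K₀} {G : Type} [Group G]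
    {𝓜 : IntegralModel (𝓞 F) F ((thickening F Fi).obj (S.M.obj Kc))}
    {w : HeightOneSpectrum (𝓞 F)} {hw : (IsCMField.complexConj F) • w ≠ w} {h𝓨 : (𝓜.localise w).IsSmoothProper 1}
    {θ : ActionOver (𝓜.localise w).total.hom ((Fi ≃ₐ[F] Fi) × G)}
    {e : Fi →ₐ[F] AlgebraicClosure (w.adicCompletion F)}


variable (I : RGDInputsAt F ι₁ Jstar K₀ S hU7ₛ hJ hJu Fi Kc G 𝓜 w hw h𝓨 θ e)

/-- **the CHOSEN §1c bijection `eLOf I y : LineWOf I y ≃ {J ∕∕ AdmKWOf I y J}`**. [cite: Tate1997FiniteFlatGroupSchemes, (3.7)] -/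
def eLWOf (y : AlgPoints (S.M.obj Kc) (AlgebraicClosure (w.adicCompletion F))) : LineWOf I y ≃ {J : Ideal (Alg (layerΩW I y)) // AdmKWOf I y J} :=
  (exists_equiv_lineWOf_admKW I y).choose

open scoped MonObj CategoryTheory.Obj in
/-- its membership law (§1c). [cite: GortzWedhorn2023, §(27.2) (27.2.1) (p. 607)] -/
theorem eLWOf_le_ker_iff (y : AlgPoints (S.M.obj Kc) (AlgebraicClosure (w.adicCompletion F))) (L : LineWOf I y) (s : specOver (AlgebraicClosure (w.adicCompletion F)) (AlgebraicClosure (w.adicCompletion F)) ⟶ layerΩW I y) :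
    haveI := isMonHom_transRW I y
    haveI := isAffine_layerΩW_left I y
    (eLWOf I y L).1 ≤ RingHom.ker (ptEquiv (layerΩW I y) (AlgebraicClosure (w.adicCompletion F)) s).toRingHom ↔
      (s ≫ (Over.pullback (sΩ w)).map (ιRW I y) ≫ (isoGenericOf I y).inv : (fibreΩOf S Kc 𝓜 w e I.univ y).Points (AlgebraicClosure (w.adicCompletion F))) ∈ L.1 :=
  (exists_equiv_lineWOf_admKW I y).choose_spec L s


end ELW

/-! ## §W3 (generic) Base-point transport of a kill printed through the three-piece isomorphism (= KillEngine v2 §3; DROP for an import once served) -/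

section TransportW

universe u

open scoped MonObj CategoryTheory.Obj

-- (K6 ★ twin — gate `dedup.landed`, dealer LA3-plan (g5)): the tree's W-copy `comp_threePiece_inv_comp_eq_one_of_eq_W` (= KillEngine §3,
-- token-for-token) is DELETED here; its one caller (PART 3, `exists_closedSub_kill_of_lineW`) uses ★ `…F0P6aLineSpecialisation.comp_threePiece_inv_comp_eq_one_of_eq`
-- from ★ `Theorems/F0P6aKillEngineKillEngine.lean` (same namespace, identical statement).

end TransportW

/-! ## §L′  κ-SIDE TWINS: the special fibre of the `𝔭_w`-layer — kernel iso, closedness, the kill by `𝔭_w`; `spIWOf` and its corank -/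

section SpecialW

set_option synthInstance.maxHeartbeats 100000

open Literature.AlgebraicGeometry.GroupSchemes (GroupSchemeKernel.ker GroupSchemeKernel.kerι)
open Literature.AlgebraicGeometry.GroupSchemes.AffineGroupScheme (ptEquiv spI isHopfIdeal_and_finrank_and_map_le_spI)

variable {F : Type} [Field F] [NumberField F] [IsCMField F] {ι₁ : F →+* ℂ}
    {Jstar : Matrix (Fin 2) (Fin 2) F}
    {K₀ : C5.OpenCompactSubgroup ↥(finAdelic ↥(maximalRealSubfield F) F (IsCMField.complexConj F) 2 Jstar)}
    {S : RecordSystemGS F Jstar ι₁ K₀} {hU7ₛ : S.HeckeTranslateDefinedOver}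
    {hJ : (Jstar.map (IsCMField.complexConj F))ᵀ = Jstar} {hJu : IsUnit Jstar}
    {Fi : Type} [Field Fi] [Algebra F Fi] {Kc : C5.SmallLevel K₀} {G : Type} [Group G]
    {𝓜 : IntegralModel (𝓞 F) F ((thickening F Fi).obj (S.M.obj Kc))}
    {w : HeightOneSpectrum (𝓞 F)} {hw : (IsCMField.complexConj F) • w ≠ w} {h𝓨 : (𝓜.localise w).IsSmoothProper 1}
    {θ : ActionOver (𝓜.localise w).total.hom ((Fi ≃ₐ[F] Fi) × G)}
    {e : Fi →ₐ[F] AlgebraicClosure (w.adicCompletion F)}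

variable (I : RGDInputsAt F ι₁ Jstar K₀ S hU7ₛ hJ hJu Fi Kc G 𝓜 w hw h𝓨 θ e)

set_option maxHeartbeats 400000 in
open scoped MonObj CategoryTheory.Obj in
set_option backward.isDefEq.respectTransparency false in
/-- **★ (S-c) §3 READ FOR THE SPECIAL FIBRE OF THE `𝔭_w`-LAYER**: `layerκW I y ≅ Ker ψ_{P_w}(A_κ̄)` over `A_κ̄ := (famOf I y) ×_R κ̄`, compatibly with `(ιRW)_κ̄` and `kerι`
(★ `IdealTorsion.exists_baseChange_iso` at `g := sκ w`; the twin of §L `exists_iso_layerΩW_ker`). [cite: GortzWedhorn2020, (4.15), p. 116 and Definition 4.45 (2), p. 117]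
[cite: Conrad2004GrossZagier, §7 (Thm. 7.5)] -/
theorem exists_iso_layerκW_ker (y : AlgPoints (S.M.obj Kc) (AlgebraicClosure (w.adicCompletion F))) :
    haveI := isCommMonObj_famOf I y
    ∃ eg : layerκW I y ≅
        GroupSchemeKernel.ker (@serreTranslate _ ((famOf I y).baseChange (sκ w)) (𝓞 F) _ ((actFamOf I y).baseChange (sκ w))
          (isCommMonObj_baseChange (sκ w)) (mWOf w) (EWOf w) (EWOf_idem w) (PWOf w)),
      eg.hom ≫ GroupSchemeKernel.kerι _ = (Over.pullback (sκ w)).map (ιRW I y) := by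
  haveI := isCommMonObj_famOf I y
  exact IdealTorsion.exists_baseChange_iso (actFamOf I y) (EWOf w) (EWOf_idem w) (PWOf w) (sκ w) (presW_laws w).2.1

set_option maxHeartbeats 400000 in
open scoped MonObj CategoryTheory.Obj in
set_option backward.isDefEq.respectTransparency false in
/-- **`(ιRW)_κ̄ : layerκW I y ⟶ A_κ̄` IS A CLOSED IMMERSION** (an isomorphism followed by ★ (S-c) `isClosedImmersion_kerι_serreTranslate_left` at the base-changed family).
[cite: GortzWedhorn2020, Definition 4.45 (2), p. 117] [cite: GortzWedhorn2023, (27.1.1)] -/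
theorem isClosedImmersion_pullback_map_ιRW_left (y : AlgPoints (S.M.obj Kc) (AlgebraicClosure (w.adicCompletion F))) :
    IsClosedImmersion ((Over.pullback (sκ w)).map (ιRW I y)).left := by
  haveI := isCommMonObj_famOf I y
  haveI : IsCommMonObj ((famOf I y).baseChange (sκ w)).X := isCommMonObj_baseChange _
  obtain ⟨eg, heg⟩ := exists_iso_layerκW_ker I y
  haveI := IdealTorsion.isClosedImmersion_kerι_serreTranslate_left ((actFamOf I y).baseChange (sκ w)) (EWOf w) (EWOf_idem w) (PWOf w)
  haveI : IsIso eg.hom.left := inferInstanceAs (IsIso ((Over.forget _).map eg.hom))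
  rw [← heg, Over.comp_left]
  infer_instance

set_option maxHeartbeats 400000 in
open scoped MonObj CategoryTheory.Obj in
set_option backward.isDefEq.respectTransparency false in
/-- **`(ιRW)_κ̄` IS KILLED BY `𝔭_w`**: `(ιRW)_κ̄ ≫ ι(a)_κ̄ = 1` for `a ∈ 𝔭_w` (★ (S-c) `kerι_comp_i_eq_one` at the base-changed family, moved along `exists_iso_layerκW_ker`).
[cite: Conrad2004GrossZagier, §7 (Thm. 7.5)] [cite: MilneCM2006, §7] -/
theorem pullback_map_ιRW_comp_i_eq_one (y : AlgPoints (S.M.obj Kc) (AlgebraicClosure (w.adicCompletion F))) {a : 𝓞 F} (ha : a ∈ w.asIdeal) :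
    (Over.pullback (sκ w)).map (ιRW I y) ≫ ((actFamOf I y).baseChange (sκ w)).i a = 1 := by
  haveI := isCommMonObj_famOf I y
  haveI : IsCommMonObj ((famOf I y).baseChange (sκ w)).X := isCommMonObj_baseChange _
  obtain ⟨eg, heg⟩ := exists_iso_layerκW_ker I y
  rw [← heg, Category.assoc, IdealTorsion.kerι_comp_i_eq_one ((actFamOf I y).baseChange (sκ w)) (EWOf w) (EWOf_idem w) (PWOf w)
    (presW_laws w).2.1 (presW_laws w).2.2.2.2.2 ha, MonObj.comp_one]

-- (K6 ★ twin — gate `dedup.landed`, dealer LA3-plan (g5)): the tree's `act₀Of_hom_hom_hom_eq` (`rfl` law, text-identical to ★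
-- `…F0P6aRoofCwKernel.act₀Of_hom_hom_hom`, which however carries `[IsGalois ℚ F]`) is DELETED here; its one caller (PART 3) unfolds it in place by `change`.

/-- **`spIWOf I y Hw := spI Ω̄ κ̄ (layerRW I y) (eLW Hw)`** — the specialised ideal on `Γ(layerκW I y)` of the `w`-line `Hw` (★ `spI` under `(toGeomκ w).toAlgebra`; twin of LS §1d
`spIOf`). [cite: EGAIV2, Prop. 2.8.5] -/
def spIWOf (y : AlgPoints (S.M.obj Kc) (AlgebraicClosure (w.adicCompletion F))) (Hw : LineWOf I y) : Ideal (Alg (layerκW I y)) :=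
  letI := (toGeomκ w).toAlgebra
  haveI := isMonHom_transRW I y
  haveI := isAffine_layerRW_left I y
  haveI := isAffine_layerκW_left I y
  haveI := isAffine_layerΩW_left I y
  spI (AlgebraicClosure (w.adicCompletion F)) (geomResidueField w) (layerRW I y) (eLWOf I y Hw).1

set_option maxHeartbeats 400000 in
open scoped MonObj CategoryTheory.Obj in
/-- **`spIWOf` IS ADMISSIBLE** on `layerκW I y` for `(βRW ·)_κ̄` — ★ S1 `isHopfIdeal_and_finrank_and_map_le_spI`; in particular its CORANK is `q = p^f` (twin of LS §1d
`isAdm_spIOf`). [cite: EGAIV2, Prop. 2.8.5] [cite: Milne2017, 1.e, Ch. 3 §b Props. 3.11 and 3.15] -/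
theorem isAdm_spIWOf (y : AlgPoints (S.M.obj Kc) (AlgebraicClosure (w.adicCompletion F))) (Hw : LineWOf I y) :
    haveI := isMonHom_transRW I y
    haveI := isAffine_layerκW_left I y
    (spIWOf I y Hw).IsHopfIdeal (geomResidueField w) ∧
      Module.finrank (geomResidueField w) (Alg (layerκW I y) ⧸ spIWOf I y Hw) = I.pChar ^ I.fDeg ∧
      ∀ a : 𝓞 F, (spIWOf I y Hw).map ((Over.pullback (sκ w)).map (βRW I y a)).left.appTop.hom ≤ spIWOf I y Hw := by
  letI := (toGeomκ w).toAlgebra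
  haveI := isMonHom_transRW I y
  haveI := isAffine_layerRW_left I y
  haveI := isAffine_layerκW_left I y
  haveI := isAffine_layerΩW_left I y
  haveI := moduleFinite_alg_layerRW I y
  exact isHopfIdeal_and_finrank_and_map_le_spI (AlgebraicClosure (w.adicCompletion F)) (geomResidueField w) (layerRW I y) (βRW I y) (I.pChar ^ I.fDeg)
    (eLWOf I y Hw).1 (eLWOf I y Hw).2

end SpecialW

/-! ## §W0–§W5  THE W-PORT OF THE KILL ENGINE AND THE `w`-SIDE WITNESS -/

section KillEngineW

set_option synthInstance.maxHeartbeats 100000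

open Literature.AlgebraicGeometry.GroupSchemes (GroupSchemeKernel.ker GroupSchemeKernel.kerι GroupSchemeKernel.kerLift GroupSchemeKernel.kerLift_ι
  GroupSchemeKernel.kerι_comp GroupSchemeKernel.isClosedImmersion_kerι_left_of_isSeparated)
open Literature.AlgebraicGeometry.GroupSchemes.AffineGroupScheme (quotIncl ptEquiv spI exists_comp_quotIncl_eq_of_le_ker exists_hom_comp_eq_quotIncl_of_forall
  ptEquiv_quotIncl pullback_map_quotIncl_sat_comp_eq_one quotIncl_spI_comp_eq_one_of_pullback_map flat_specOver_quotient_sat_hom algBaseChangeEquiv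
  isClosedImmersion_quotIncl_left)

variable {F : Type} [Field F] [NumberField F] [IsCMField F] {ι₁ : F →+* ℂ}
    {Jstar : Matrix (Fin 2) (Fin 2) F}
    {K₀ : C5.OpenCompactSubgroup ↥(finAdelic ↥(maximalRealSubfield F) F (IsCMField.complexConj F) 2 Jstar)}
    {S : RecordSystemGS F Jstar ι₁ K₀} {hU7ₛ : S.HeckeTranslateDefinedOver}
    {hJ : (Jstar.map (IsCMField.complexConj F))ᵀ = Jstar} {hJu : IsUnit Jstar}
    {Fi : Type} [Field Fi] [Algebra F Fi] {Kc : C5.SmallLevel K₀} {G : Type} [Group G]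
    {𝓜 : IntegralModel (𝓞 F) F ((thickening F Fi).obj (S.M.obj Kc))}
    {w : HeightOneSpectrum (𝓞 F)} {hw : (IsCMField.complexConj F) • w ≠ w} {h𝓨 : (𝓜.localise w).IsSmoothProper 1}
    {θ : ActionOver (𝓜.localise w).total.hom ((Fi ≃ₐ[F] Fi) × G)}
    {e : Fi →ₐ[F] AlgebraicClosure (w.adicCompletion F)}

variable (I : RGDInputsAt F ι₁ Jstar K₀ S hU7ₛ hJ hJu Fi Kc G 𝓜 w hw h𝓨 θ e)

/-! ### §W0 the saturation of the `w`-line's admissible ideal and the inclusion of its flat closure into the lifted family -/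

/-- **`satWOf I y Hw := J^sat`**, `J = (eLWOf I y Hw).1` (★ p849577's saturation, spelled out; W-twin of KillEngine `satOf`). [cite: EGAIV2, Prop. 2.8.5] -/
abbrev satWOf (y : AlgPoints (S.M.obj Kc) (AlgebraicClosure (w.adicCompletion F))) (Hw : LineWOf I y) :
    haveI := isMonHom_transRW I y
    Ideal (Alg (layerRW I y)) :=
  haveI := isMonHom_transRW I y
  haveI := isAffine_layerRW_left I y
  haveI := isAffine_layerΩW_left I y
  ((eLWOf I y Hw).1.map (algBaseChangeEquiv (AlgebraicClosure (w.adicCompletion F)) (layerRW I y))).comap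
    (Algebra.TensorProduct.includeRight : Alg (layerRW I y) →ₐ[↥(closureValuationSubring (w.adicCompletion F))]
      TensorProduct ↥(closureValuationSubring (w.adicCompletion F)) (AlgebraicClosure (w.adicCompletion F)) (Alg (layerRW I y)))

/-- **`closureInclWOf I y Hw : V(J^sat) ⟶ famOf I y`** (W-twin of KillEngine `closureInclOf`). [cite: EGAIV2, Prop. 2.8.5] [cite: GortzWedhorn2020, Definition 4.45 (2), p. 117] -/
abbrev closureInclWOf (y : AlgPoints (S.M.obj Kc) (AlgebraicClosure (w.adicCompletion F))) (Hw : LineWOf I y) :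
    haveI := isMonHom_transRW I y
    haveI := isAffine_layerRW_left I y
    specOver ↥(closureValuationSubring (w.adicCompletion F)) (Alg (layerRW I y) ⧸ satWOf I y Hw) ⟶ (famOf I y).X :=
  haveI := isMonHom_transRW I y
  haveI := isAffine_layerRW_left I y
  quotIncl (layerRW I y) (satWOf I y Hw) ≫ ιRW I y

/-- `V(J^sat) → Spec R` is FLAT (★ p849577 `flat_specOver_quotient_sat_hom`). [cite: EGAIV2, Prop. 2.8.5] [cite: StacksProject, Tag 0539] -/
theorem flat_closureW_hom (y : AlgPoints (S.M.obj Kc) (AlgebraicClosure (w.adicCompletion F))) (Hw : LineWOf I y) :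
    haveI := isMonHom_transRW I y
    haveI := isAffine_layerRW_left I y
    Flat (specOver ↥(closureValuationSubring (w.adicCompletion F)) (Alg (layerRW I y) ⧸ satWOf I y Hw)).hom := by
  haveI := isMonHom_transRW I y
  haveI := isAffine_layerRW_left I y
  haveI := isAffine_layerΩW_left I y
  exact flat_specOver_quotient_sat_hom (AlgebraicClosure (w.adicCompletion F)) (layerRW I y) (eLWOf I y Hw).1


/-! (★ re-home, size lint: PART 2 of 3 ends here at tree line :698; continued in `Theorems/F0P6aKillEngineW.lean`.) -/

end KillEngineW
end Summit.HodgeConjecture.HodgeConjecture.Cruxes.HLiu418.F0P6aLineSpecialisation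
end
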